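import Mathlib
import Summits.Ventures.PercRepro2.UniversalClosures
import Summits.Ventures.PercRepro2.V2SeriesClosure

/-! # The series step of (UH*), fibre-wise: the abstract theorem modulo the residual family
(seat mine-b, cell pub-perc-repro2; MINE-B.md §25.1, §25.6)

Let `(X, r, b)` and `(Y, r′, b′)` be finite labelled preorders and `X ∧ Y` their series product
(labels `serR = min (r x) (r′ z)`, `serB = min (b x) (b′ z)`).  A source `(x, z)` of `X ∧ Y` has
`r x = 0` or `r′ z = 0`.  Given

* an (UH*) assignment `f` of `X` (every source `x` owns `b x` private `y ≤ x` with `r y = 1`,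
  `b y ≥ b x − 1`) and one `g` of `Y`;
* a **relay** `σ` of `Y`: an injection of `{b′ ≥ 1}` into `{r′ ≥ 1}` with `σ z ≤ z` and
  `b′ (σ z) ≥ b′ z − 1`;
* a **red-up** map `θ` of `X`: an injection of `{r ≥ 1, b ≥ 2}` into `{r ≥ 2}` with `θ x ≤ x` and
  `b (θ x) ≥ b x − 1`;
* a **residual** assignment `ψ` of the sources `(x, z)` with `r x ≥ 1`, `b x = 1`, `r′ z = 0`:
  injective, below, red label `1`, and avoiding `Im f × Im σ` and `Im θ × Im g`,

the map  slot `i` of `(x, z)` ↦ `(f (x, i), σ z)` if `r x = 0`, `(θ x, g (z, i))` if `r x ≥ 1`,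
`b x ≥ 2`, and `ψ (x, z)` otherwise  is an (UH*) assignment of `X ∧ Y` (`universal_ser_of_maps`).
The three families are separated by the red label of the first coordinate (`1` / `≥ 2`) and by the
avoidance hypothesis; inside a family the injectivity of `f`, `σ`, `θ`, `g`, `ψ` decodes the slot.
On the cubes of series–parallel networks `σ` and `θ` exist on every network with `≤ 8` edges
(MINE-B.md §25.4); for `Y` a bundle of `K ≥ 3` edges the residual family is served by the spare
targets of the fibres and the level-1 condition (L1) of §25.2. -/

namespace Summit.Ventures.PercRepro2.UHClosure

open Finset
open Summit.Ventures.PercRepro2.V2Closure (serR serB)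

variable {X Y : Type*} [Preorder X] [Preorder Y] [Fintype X] [Fintype Y]

section maps

variable (r b : X → ℕ) (r' b' : Y → ℕ)

omit [Preorder X] [Preorder Y] [Fintype X] [Fintype Y] in
/-- a source of the series product has both blue labels `≥ 1` -/
lemma ser_src_blue {p : X × Y} (h : USrc (serR r r') (serB b b') p) : 1 ≤ b p.1 ∧ 1 ≤ b' p.2 := by
  have := h.2; simp only [serB] at this; omega

omit [Preorder X] [Preorder Y] [Fintype X] [Fintype Y] in
/-- a source of the series product has a red label `0` in one coordinate -/
lemma ser_src_red {p : X × Y} (h : USrc (serR r r') (serB b b') p) : r p.1 = 0 ∨ r' p.2 = 0 := by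
  have := h.1; simp only [serR] at this; omega

/-- the `X`-slot of a product slot whose first coordinate is a source of `X` -/
def serSlotX (q : SlotL (USrc (serR r r') (serB b b')) (serB b b')) (hx : r q.1.1.1.1 = 0) :
    SlotL (USrc r b) b :=
  ⟨⟨⟨q.1.1.1.1, ⟨hx, (ser_src_blue r b r' b' q.1.1.2.1).1⟩, (ser_src_blue r b r' b' q.1.1.2.1).1⟩,
    ⟨q.1.2.val, by
      have h1 := q.2; have h2 := lt_boundL b q.1.1.1.1; simp only [serB] at h1; omega⟩⟩,
   by have h1 := q.2; simp only [serB] at h1; simp only; omega⟩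

/-- the `Y`-slot of a product slot whose second coordinate is a source of `Y` -/
def serSlotY (q : SlotL (USrc (serR r r') (serB b b')) (serB b b')) (hz : r' q.1.1.1.2 = 0) :
    SlotL (USrc r' b') b' :=
  ⟨⟨⟨q.1.1.1.2, ⟨hz, (ser_src_blue r b r' b' q.1.1.2.1).2⟩, (ser_src_blue r b r' b' q.1.1.2.1).2⟩,
    ⟨q.1.2.val, by
      have h1 := q.2; have h2 := lt_boundL b' q.1.1.1.2; simp only [serB] at h1; omega⟩⟩,
   by have h1 := q.2; simp only [serB] at h1; simp only; omega⟩

omit [Preorder X] [Preorder Y] in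
/-- the source of the `X`-slot -/
@[simp] lemma serSlotX_src (q : SlotL (USrc (serR r r') (serB b b')) (serB b b')) (hx : r q.1.1.1.1 = 0) :
    (serSlotX r b r' b' q hx).1.1.1 = q.1.1.1.1 := rfl

omit [Preorder X] [Preorder Y] in
/-- the index of the `X`-slot -/
@[simp] lemma serSlotX_idx (q : SlotL (USrc (serR r r') (serB b b')) (serB b b')) (hx : r q.1.1.1.1 = 0) :
    (serSlotX r b r' b' q hx).1.2.val = q.1.2.val := rfl

omit [Preorder X] [Preorder Y] in
/-- the source of the `Y`-slot -/
@[simp] lemma serSlotY_src (q : SlotL (USrc (serR r r') (serB b b')) (serB b b')) (hz : r' q.1.1.1.2 = 0) :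
    (serSlotY r b r' b' q hz).1.1.1 = q.1.1.1.2 := rfl

omit [Preorder X] [Preorder Y] in
/-- the index of the `Y`-slot -/
@[simp] lemma serSlotY_idx (q : SlotL (USrc (serR r r') (serB b b')) (serB b b')) (hz : r' q.1.1.1.2 = 0) :
    (serSlotY r b r' b' q hz).1.2.val = q.1.2.val := rfl

/-- the fibre-wise series assignment: `(f (x, i), σ z)` on the sources of the first kind,
`(θ x, g (z, i))` on the red-positive blue-`≥ 2` first coordinates, the residual `ψ` on the rest -/
noncomputable def serAssign (f : SlotL (USrc r b) b → X) (g : SlotL (USrc r' b') b' → Y)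
    (σ : Y → Y) (θ : X → X) (ψ : X × Y → X × Y)
    (q : SlotL (USrc (serR r r') (serB b b')) (serB b b')) : X × Y :=
  if hx : r q.1.1.1.1 = 0 then (f (serSlotX r b r' b' q hx), σ q.1.1.1.2)
  else if hb : 2 ≤ b q.1.1.1.1 then
    (θ q.1.1.1.1, g (serSlotY r b r' b' q (by
      rcases ser_src_red r b r' b' q.1.1.2.1 with h | h
      · exact absurd h hx
      · exact h)))
  else ψ q.1.1.1

end maps

omit [Preorder X] [Preorder Y] in
/-- two product slots with the same source and the same index are equal -/
lemma ser_slot_ext {S : X × Y → Prop} [DecidablePred S] {d : X × Y → ℕ} (q q' : SlotL S d)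
    (h1 : q.1.1.1 = q'.1.1.1) (h2 : q.1.2.val = q'.1.2.val) : q = q' := by
  apply Subtype.ext; apply Prod.ext
  · exact Subtype.ext h1
  · exact Fin.ext h2

/-- **THE SERIES STEP OF (UH*), MODULO THE RESIDUAL FAMILY.**  Given an (UH*) assignment `f` of
`X`, a relay `σ` of `Y`, a red-up map `θ` of `X`, an (UH*) assignment `g` of `Y`, and a residual
assignment `ψ` of the sources `(x, z)` with `r x ≥ 1`, `b x = 1`, `r′ z = 0` that avoids
`Im f × Im σ` and `Im θ × Im g`, the series product satisfies (UH*). -/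
theorem universal_ser_of_maps (r b : X → ℕ) (r' b' : Y → ℕ)
    (f : SlotL (USrc r b) b → X) (hf : Function.Injective f)
    (hfs : ∀ p, f p ≤ p.1.1.1 ∧ r (f p) = 1 ∧ b p.1.1.1 ≤ b (f p) + 1)
    (g : SlotL (USrc r' b') b' → Y) (hg : Function.Injective g)
    (hgs : ∀ p, g p ≤ p.1.1.1 ∧ r' (g p) = 1 ∧ b' p.1.1.1 ≤ b' (g p) + 1)
    (σ : Y → Y) (hσ : ∀ z z', 1 ≤ b' z → 1 ≤ b' z' → σ z = σ z' → z = z')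
    (hσs : ∀ z, 1 ≤ b' z → σ z ≤ z ∧ 1 ≤ r' (σ z) ∧ b' z ≤ b' (σ z) + 1)
    (θ : X → X) (hθ : ∀ x x', 1 ≤ r x → 2 ≤ b x → 1 ≤ r x' → 2 ≤ b x' → θ x = θ x' → x = x')
    (hθs : ∀ x, 1 ≤ r x → 2 ≤ b x → θ x ≤ x ∧ 2 ≤ r (θ x) ∧ b x ≤ b (θ x) + 1)
    (ψ : X × Y → X × Y)
    (hψ : ∀ p p', 1 ≤ r p.1 → b p.1 = 1 → r' p.2 = 0 → 1 ≤ r p'.1 → b p'.1 = 1 → r' p'.2 = 0 →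
      ψ p = ψ p' → p = p')
    (hψs : ∀ p, 1 ≤ r p.1 → b p.1 = 1 → r' p.2 = 0 → 1 ≤ b' p.2 →
      ψ p ≤ p ∧ serR r r' (ψ p) = 1 ∧
      ((∀ q, f q ≠ (ψ p).1) ∨ (∀ z, 1 ≤ b' z → σ z ≠ (ψ p).2)) ∧
      ((∀ x, 1 ≤ r x → 2 ≤ b x → θ x ≠ (ψ p).1) ∨ (∀ q, g q ≠ (ψ p).2))) :
    Universal (serR r r') (serB b b') := by
  refine ⟨serAssign r b r' b' f g σ θ ψ, ?_, ?_⟩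
  · -- injectivity
    intro q q' hqq'
    have hsrc := q.1.1.2.1
    have hsrc' := q'.1.1.2.1
    have hblue := ser_src_blue r b r' b' hsrc
    have hblue' := ser_src_blue r b r' b' hsrc'
    have hred := ser_src_red r b r' b' hsrc
    have hred' := ser_src_red r b r' b' hsrc'
    have hi := q.2
    have hi' := q'.2
    simp only [serB] at hi hi'
    unfold serAssign at hqq'
    by_cases hx : r q.1.1.1.1 = 0 <;> by_cases hx' : r q'.1.1.1.1 = 0
    · -- (I) vs (I)
      rw [dif_pos hx, dif_pos hx'] at hqq'
      have h1 : f (serSlotX r b r' b' q hx) = f (serSlotX r b r' b' q' hx') := (Prod.mk.inj hqq').1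
      have h2 : σ q.1.1.1.2 = σ q'.1.1.1.2 := (Prod.mk.inj hqq').2
      have h3 := hf h1
      have hxx : q.1.1.1.1 = q'.1.1.1.1 :=
        congrArg (fun s : SlotL (USrc r b) b => s.1.1.1) h3
      have hidx : q.1.2.val = q'.1.2.val :=
        congrArg (fun s : SlotL (USrc r b) b => s.1.2.val) h3
      have hzz : q.1.1.1.2 = q'.1.1.1.2 := hσ _ _ hblue.2 hblue'.2 h2
      exact ser_slot_ext q q' (Prod.ext hxx hzz) hidx
    · -- (I) vs (II)
      exfalso
      rw [dif_pos hx, dif_neg hx'] at hqq'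
      have hz' : r' q'.1.1.1.2 = 0 := by
        rcases hred' with h | h
        · exact absurd h hx'
        · exact h
      by_cases hb' : 2 ≤ b q'.1.1.1.1
      · rw [dif_pos hb'] at hqq'
        have h1 : f (serSlotX r b r' b' q hx) = θ q'.1.1.1.1 := (Prod.mk.inj hqq').1
        have hr1 := (hfs (serSlotX r b r' b' q hx)).2.1
        have hr2 := (hθs q'.1.1.1.1 (by omega) hb').2.1
        rw [h1] at hr1; omega
      · rw [dif_neg hb'] at hqq'
        obtain ⟨_, _, h3, _⟩ := hψs q'.1.1.1 (by omega) (by omega) hz' hblue'.2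
        rcases h3 with h3 | h3
        · exact h3 _ (congrArg Prod.fst hqq')
        · exact h3 _ hblue.2 (congrArg Prod.snd hqq')
    · -- (II) vs (I)
      exfalso
      rw [dif_neg hx, dif_pos hx'] at hqq'
      have hz : r' q.1.1.1.2 = 0 := by
        rcases hred with h | h
        · exact absurd h hx
        · exact h
      by_cases hb : 2 ≤ b q.1.1.1.1
      · rw [dif_pos hb] at hqq'
        have h1 : θ q.1.1.1.1 = f (serSlotX r b r' b' q' hx') := (Prod.mk.inj hqq').1
        have hr1 := (hfs (serSlotX r b r' b' q' hx')).2.1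
        have hr2 := (hθs q.1.1.1.1 (by omega) hb).2.1
        rw [← h1] at hr1; omega
      · rw [dif_neg hb] at hqq'
        obtain ⟨_, _, h3, _⟩ := hψs q.1.1.1 (by omega) (by omega) hz hblue.2
        rcases h3 with h3 | h3
        · exact h3 _ (congrArg Prod.fst hqq').symm
        · exact h3 _ hblue'.2 (congrArg Prod.snd hqq').symm
    · -- (II) vs (II)
      rw [dif_neg hx, dif_neg hx'] at hqq'
      have hz : r' q.1.1.1.2 = 0 := by
        rcases hred with h | h
        · exact absurd h hx
        · exact h
      have hz' : r' q'.1.1.1.2 = 0 := by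
        rcases hred' with h | h
        · exact absurd h hx'
        · exact h
      by_cases hb : 2 ≤ b q.1.1.1.1 <;> by_cases hb' : 2 ≤ b q'.1.1.1.1
      · -- (II-Q) vs (II-Q)
        rw [dif_pos hb, dif_pos hb'] at hqq'
        have h1 : θ q.1.1.1.1 = θ q'.1.1.1.1 := (Prod.mk.inj hqq').1
        have h2 : g (serSlotY r b r' b' q hz) = g (serSlotY r b r' b' q' hz') := (Prod.mk.inj hqq').2
        have hxx : q.1.1.1.1 = q'.1.1.1.1 := hθ _ _ (by omega) hb (by omega) hb' h1
        have h3 := hg h2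
        have hzz : q.1.1.1.2 = q'.1.1.1.2 :=
          congrArg (fun s : SlotL (USrc r' b') b' => s.1.1.1) h3
        have hidx : q.1.2.val = q'.1.2.val :=
          congrArg (fun s : SlotL (USrc r' b') b' => s.1.2.val) h3
        exact ser_slot_ext q q' (Prod.ext hxx hzz) hidx
      · -- (II-Q) vs (II-P)
        exfalso
        rw [dif_pos hb, dif_neg hb'] at hqq'
        obtain ⟨_, _, _, h4⟩ := hψs q'.1.1.1 (by omega) (by omega) hz' hblue'.2
        rcases h4 with h4 | h4
        · exact h4 _ (by omega) hb (congrArg Prod.fst hqq')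
        · exact h4 _ (congrArg Prod.snd hqq')
      · -- (II-P) vs (II-Q)
        exfalso
        rw [dif_neg hb, dif_pos hb'] at hqq'
        obtain ⟨_, _, _, h4⟩ := hψs q.1.1.1 (by omega) (by omega) hz hblue.2
        rcases h4 with h4 | h4
        · exact h4 _ (by omega) hb' (congrArg Prod.fst hqq').symm
        · exact h4 _ (congrArg Prod.snd hqq').symm
      · -- (II-P) vs (II-P)
        rw [dif_neg hb, dif_neg hb'] at hqq'
        have hpp : q.1.1.1 = q'.1.1.1 :=
          hψ _ _ (by omega) (by omega) hz (by omega) (by omega) hz' hqq'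
        have hidx : q.1.2.val = q'.1.2.val := by
          have e1 : q.1.1.1.1 = q'.1.1.1.1 := congrArg Prod.fst hpp
          rw [e1] at hi; omega
        exact ser_slot_ext q q' hpp hidx
  · -- the targets
    intro q
    have hsrc := q.1.1.2.1
    have hblue := ser_src_blue r b r' b' hsrc
    have hred := ser_src_red r b r' b' hsrc
    have hi := q.2
    simp only [serB] at hi
    unfold serAssign
    by_cases hx : r q.1.1.1.1 = 0
    · rw [dif_pos hx]
      obtain ⟨hle, hr, hb⟩ := hfs (serSlotX r b r' b' q hx)
      obtain ⟨hle', hr', hb'⟩ := hσs q.1.1.1.2 hblue.2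
      refine ⟨Prod.mk_le_mk.2 ⟨hle, hle'⟩, ?_, ?_⟩
      · simp only [serR]; omega
      · simp only [serB, serSlotX_src] at hb ⊢; omega
    · rw [dif_neg hx]
      have hz : r' q.1.1.1.2 = 0 := by
        rcases hred with h | h
        · exact absurd h hx
        · exact h
      by_cases hb : 2 ≤ b q.1.1.1.1
      · rw [dif_pos hb]
        obtain ⟨hle, hr, hbb⟩ := hθs q.1.1.1.1 (by omega) hb
        obtain ⟨hle', hr', hb'⟩ := hgs (serSlotY r b r' b' q hz)
        refine ⟨Prod.mk_le_mk.2 ⟨hle, hle'⟩, ?_, ?_⟩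
        · simp only [serR]; omega
        · simp only [serB, serSlotY_src] at hb' ⊢; omega
      · rw [dif_neg hb]
        obtain ⟨hle, hr, _, _⟩ := hψs q.1.1.1 (by omega) (by omega) hz hblue.2
        refine ⟨hle, hr, ?_⟩
        simp only [serB]; omega

end Summit.Ventures.PercRepro2.UHClosure
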